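import Summits.AnomalousDissipation.AnomalousDissipation.Theorems.MomentParityQuarticGateAssembly
import Summits.AnomalousDissipation.AnomalousDissipation.Theorems.MomentParityQuarticGateEnstrophy
import Summits.AnomalousDissipation.AnomalousDissipation.Theorems.MomentParityQuarticGateCoords
import Summits.AnomalousDissipation.AnomalousDissipation.Theorems.MomentParityQuarticGateRealize
import Summits.AnomalousDissipation.AnomalousDissipation.Theorems.MomentParityQuarticGateRowPoly
import Summits.AnomalousDissipation.AnomalousDissipation.Theses.MomentParity
import Literature.Analysis.FluidPDE.BeltramiWavesCurl

/-!
# Stub `stub_order3Surgery` (S5) of the line `recession-cone`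
# (crux `MomentParity.QuarticGate`, stmt-AnomalousDissipation-11464)

**Order-3 surgery + Slater upgrade.** A level-`N` probability law `μ₀` with bounded support and
nondegenerate covariance whose linear rows, energy row and helicity row vanish, at a level where
QuadRigidity holds, is upgraded to a level-`N` law `μ₁` with finite fourth moments, Slater in
degree `4`, 3-stationary, with the same mean energy and dissipation. This file is pure glue: the
conditional assembly `order3Surgery_of` (`…Assembly.lean`: FATTEN `…Fatten`, lambda-positivity
`…LambdaPositivity`, QuadRange `…QuadRange`, transport `…Transport`/`…Rows`, kernel step
`…Rows`/`…Kernel`, enstrophy polynomial `…Enstrophy`) fed with the band-basis infrastructure of the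
line (`exists_bandBasis`, the coordinate calculus of `…Coords`, REALIZE
`exists_measure_of_strictlyKPositive`, the row polynomial `exists_rowPoly`). Statement copied
byte-for-byte from the registered skeleton `Cruxes/QuarticGate/Lines/recession-cone.lean`; it is
obtained from `order3Surgery` (the same statement through the `LevelCeiling` vocabulary, which is
the registered sub-goal: the skeleton's own registration of `stub_order3Surgery` is truncated at
4000 bytes and cannot be matched by the gate) by definitional unfolding.
-/

-- `Summit.<Summit>.<Problem>` is the tree's mandated summit-side namespace (CONVENTIONS §2); for this
-- single-conjunct summit the two coincide, so the duplicate is deliberate.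
set_option linter.dupNamespace false

namespace Summit.AnomalousDissipation.AnomalousDissipation.Theorems.MomentParityQuarticGate

open MeasureTheory Filter
open Literature.Analysis.FunctionSpaces Literature.Analysis.FluidPDE
open Summit.AnomalousDissipation.AnomalousDissipation.Theses.MomentParity
open Summit.AnomalousDissipation.AnomalousDissipation.Theorems.QuarticGate.Negative

/-- **Order-3 surgery + Slater upgrade** (= `stub_order3Surgery` below, stated through the
vocabulary `IsLevel` / `IsBandTest` / `polyGrad` / `IsPolyStationary` of
`Theorems/QuarticGate/Negative/LevelCeiling.lean`, which unfolds definitionally to the crux clauses;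
registered sub-goal `order3Surgery` of stmt-AnomalousDissipation-11464). [folklore] -/
theorem order3Surgery :
    ∀ (ν : ℝ) (f : UnitAddTorus (Fin 3) → EuclideanSpace ℝ (Fin 3)) (N : ℕ) (μ₀ : Measure
      (Torus.energySpace (Fin 3))), Torus.IsSmooth f → IsProbabilityMeasure μ₀ → (∀ᵐ u ∂μ₀, IsLevel
      N u) → (∃ R : ℝ, ∀ᵐ u ∂μ₀, ‖u‖ ≤ R) → (∀ g : UnitAddTorus (Fin 3) → EuclideanSpace ℝ (Fin 3),
      IsBandTest N g → (∃ u : Torus.energySpace (Fin 3), IsLevel N u ∧ Torus.pairing u.1 g ≠ 0) → (∫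
      u : Torus.energySpace (Fin 3), Torus.pairing u.1 g ∂μ₀) ^ 2 < ∫ u : Torus.energySpace (Fin 3),
      (Torus.pairing u.1 g) ^ 2 ∂μ₀) → (∀ g : UnitAddTorus (Fin 3) → EuclideanSpace ℝ (Fin 3),
      IsBandTest N g → Integrable (fun u : Torus.energySpace (Fin 3) => Torus.nsGeneratorPairing ν f
      u g) μ₀ ∧ ∫ u : Torus.energySpace (Fin 3), Torus.nsGeneratorPairing ν f u g ∂μ₀ = 0) →
      (Integrable (fun u : Torus.energySpace (Fin 3) => Torus.nsGeneratorPairing ν f u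
      (Torus.fourierTruncate N (u.1 : UnitAddTorus (Fin 3) → EuclideanSpace ℝ (Fin 3)))) μ₀ ∧ ∫ u :
      Torus.energySpace (Fin 3), Torus.nsGeneratorPairing ν f u (Torus.fourierTruncate N (u.1 :
      UnitAddTorus (Fin 3) → EuclideanSpace ℝ (Fin 3))) ∂μ₀ = 0) → (Integrable (fun u :
      Torus.energySpace (Fin 3) => Torus.nsGeneratorPairing ν f u (BDSV.curl (Torus.fourierTruncate
      N (u.1 : UnitAddTorus (Fin 3) → EuclideanSpace ℝ (Fin 3))))) μ₀ ∧ ∫ u : Torus.energySpace (Fin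
      3), Torus.nsGeneratorPairing ν f u (BDSV.curl (Torus.fourierTruncate N (u.1 : UnitAddTorus
      (Fin 3) → EuclideanSpace ℝ (Fin 3)))) ∂μ₀ = 0) → (∀ (m : ℕ) (g : Fin m → UnitAddTorus (Fin 3)
      → EuclideanSpace ℝ (Fin 3)) (P : MvPolynomial (Fin m) ℝ), (∀ i, IsBandTest N (g i)) →
      P.IsHomogeneous 2 → (∀ u : Torus.energySpace (Fin 3), IsLevel N u → Torus.nsGeneratorPairing
      (d := Fin 3) 0 0 u (polyGrad g P u) = 0) → ∃ α β : ℝ, ∀ u : Torus.energySpace (Fin 3), IsLevel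
      N u → ∀ x, polyGrad g P u x = (2 * α) • Torus.fourierTruncate N (u.1 : UnitAddTorus (Fin 3) →
      EuclideanSpace ℝ (Fin 3)) x + (2 * β) • BDSV.curl (Torus.fourierTruncate N (u.1 : UnitAddTorus
      (Fin 3) → EuclideanSpace ℝ (Fin 3))) x) → ∃ μ₁ : Measure (Torus.energySpace (Fin 3)),
      IsProbabilityMeasure μ₁ ∧ (∀ᵐ u ∂μ₁, IsLevel N u) ∧ Integrable (fun u : Torus.energySpace (Fin
      3) => ‖u‖ ^ 4) μ₁ ∧ (∀ (m : ℕ) (g : Fin m → UnitAddTorus (Fin 3) → EuclideanSpace ℝ (Fin 3))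
      (P : MvPolynomial (Fin m) ℝ), (∀ i, IsBandTest N (g i)) → P.totalDegree ≤ 4 → (∀ u :
      Torus.energySpace (Fin 3), IsLevel N u → 0 ≤ MvPolynomial.eval (fun j => Torus.pairing u.1 (g
      j)) P) → (∃ u : Torus.energySpace (Fin 3), IsLevel N u ∧ MvPolynomial.eval (fun j =>
      Torus.pairing u.1 (g j)) P ≠ 0) → 0 < ∫ u, MvPolynomial.eval (fun j => Torus.pairing u.1 (g
      j)) P ∂μ₁) ∧ IsPolyStationary ν f N 3 μ₁ ∧ Torus.ensembleEnergy μ₁ = Torus.ensembleEnergy μ₀ ∧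
      Torus.ensembleDissipation ν μ₁ = Torus.ensembleDissipation ν μ₀ := by
  intro ν f N μ₀ hf hp₀ hl₀ hR₀ hnd₀ hlin₀ hErow₀ hHrow₀ hQuad
  obtain ⟨n, b, hb, hbo, hbs⟩ := exists_bandBasis N
  haveI := hp₀
  have hbsm : ∀ i, Torus.IsSmooth (b i) := fun i => (hb i).1
  obtain ⟨D, hDdeg, hD⟩ := exists_gradNormSq_poly hbsm
  exact order3Surgery_of hb (fun ξ => sum_smul_band Finset.univ ξ hb)
    (fun ξ i => integral_inner_sum_smul_left hb hbo ξ i)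
    (fun g hg u => pairing_band_eq_sum hb hbs hg u) (fun g hg x => band_eq_sum_smul hbs hg x)
    (fun x => by
      obtain ⟨u, hu, hux, -, -⟩ := exists_level_of_coords hb hbo x
      exact ⟨u, hu, hux⟩)
    (fun u hu => norm_sq_eq_sum_sq_coords hb hbo hbs u hu) ν hf
    (fun y hy0 hy => exists_measure_of_strictlyKPositive hb hbo y hy0 hy)
    (fun m g hg P d hP => exists_rowPoly hb hbo hbs ν f hf m g hg P d hP)
    ⟨D, hDdeg, fun u hu => hD _ _ (coe_ae_eq_sum_of_level hbs u hu)⟩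
    μ₀ hl₀ hR₀ hnd₀ hlin₀ hErow₀ hHrow₀ hQuad

/-- **S5 — ORDER-3 SURGERY + SLATER UPGRADE (NEW: replaces `stub_slaterUpgrade`, absorbs the
quadratic-row part of the old `stub_order3LoudNondegenerate`).** A level-`N` probability law `μ₀`
with bounded support and NONDEGENERATE covariance on `V_N` whose LINEAR rows (mean-flow balance), ENERGY
row (`∫ ⟨F(u), P_N u⟩ dμ₀ = 0`) and HELICITY row (`∫ ⟨F(u), curl P_N u⟩ dμ₀ = 0`) vanish, at a level
where QuadRigidity holds ⟹ a level-`N` law `μ₁` with finite fourth moments, Slater at degree 4,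
3-STATIONARY (all rows of test degree ≤ 2), same mean energy and dissipation.
Why true (the recession lever one order down — odd far atoms make `M₃` free modulo quadratic
Casimirs): the row of a quadratic test is affine in `(M₁,M₂,M₃)` and sees `M₃` only through the cubic
form `{p₂,B_N}`; the defect functional `p₂ ↦ row_{μ₀}(p₂)` (well defined on `p₂|_{V_N}`) vanishes on
`ker(p₂ ↦ {p₂,B_N}|_{V_N})` = quadratic Casimirs = (QuadRigidity) tests with
`∇p = 2αP_N u + 2β curl P_N u`, whose rows are `2α·(energy row) + 2β·(helicity row) = 0`; so it factors
through `{·,B_N}` and is killed by a shift `S` of the third moments. Realise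
`y_λ := (1, M₁(μ₀), M₂(μ₀), M₃(μ₀)+S, λ·M₄⁰)` for `λ ≫ 1` by Fialkow–Nie at degree 4 on frame
coordinates (strict positivity: a limit of failing normalised `p ≥ 0` would have `p₄ = 0`, then
`p₃ = 0`, then `E_{μ₀}[p_{≤2}] ≤ 0` for a nonzero nonneg quadratic polynomial — impossible with
nondegenerate covariance); push forward along the synthesis map `ℝ^F → V_N ⊂ H`. Rows of degree
`≤ 1` tests, energy and dissipation depend on `M_{≤2}` only — unchanged. Size L–XL. -/
theorem stub_order3Surgery :
    ∀ (ν : ℝ) (f : UnitAddTorus (Fin 3) → EuclideanSpace ℝ (Fin 3)) (N : ℕ) (μ₀ : Measure (Torus.energySpace (Fin 3))),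
    Torus.IsSmooth f → IsProbabilityMeasure μ₀ → (∀ᵐ u ∂μ₀, (∀ k ∉ (Torus.freqBall N).erase (0 : Fin 3 → ℤ),
          UnitAddTorus.mFourierCoeff (EuclideanSpace.complexify ∘ (u.1 : UnitAddTorus (Fin 3) → EuclideanSpace ℝ (Fin 3))) k = 0)) →
    (∃ R : ℝ, ∀ᵐ u ∂μ₀, ‖u‖ ≤ R) →
    (∀ g : UnitAddTorus (Fin 3) → EuclideanSpace ℝ (Fin 3), (Torus.IsSmooth (g) ∧ Torus.IsDivFree (g) ∧ Torus.HasZeroMean (g) ∧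
        ∀ k ∉ (Torus.freqBall N).erase (0 : Fin 3 → ℤ),
          UnitAddTorus.mFourierCoeff (EuclideanSpace.complexify ∘ (g)) k = 0) →
      (∃ u : Torus.energySpace (Fin 3), (∀ k ∉ (Torus.freqBall N).erase (0 : Fin 3 → ℤ),
          UnitAddTorus.mFourierCoeff (EuclideanSpace.complexify ∘ (u.1 : UnitAddTorus (Fin 3) → EuclideanSpace ℝ (Fin 3))) k = 0) ∧ Torus.pairing u.1 g ≠ 0) →
      (∫ u : Torus.energySpace (Fin 3), Torus.pairing u.1 g ∂μ₀) ^ 2 < ∫ u : Torus.energySpace (Fin 3), (Torus.pairing u.1 g) ^ 2 ∂μ₀) →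
    (∀ g : UnitAddTorus (Fin 3) → EuclideanSpace ℝ (Fin 3), (Torus.IsSmooth (g) ∧ Torus.IsDivFree (g) ∧ Torus.HasZeroMean (g) ∧
        ∀ k ∉ (Torus.freqBall N).erase (0 : Fin 3 → ℤ),
          UnitAddTorus.mFourierCoeff (EuclideanSpace.complexify ∘ (g)) k = 0) →
      Integrable (fun u : Torus.energySpace (Fin 3) => Torus.nsGeneratorPairing ν f u g) μ₀ ∧
      ∫ u : Torus.energySpace (Fin 3), Torus.nsGeneratorPairing ν f u g ∂μ₀ = 0) →
    (Integrable (fun u : Torus.energySpace (Fin 3) => Torus.nsGeneratorPairing ν f u (Torus.fourierTruncate N (u.1 : UnitAddTorus (Fin 3) → EuclideanSpace ℝ (Fin 3)))) μ₀ ∧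
      ∫ u : Torus.energySpace (Fin 3), Torus.nsGeneratorPairing ν f u (Torus.fourierTruncate N (u.1 : UnitAddTorus (Fin 3) → EuclideanSpace ℝ (Fin 3))) ∂μ₀ = 0) →
    (Integrable (fun u : Torus.energySpace (Fin 3) => Torus.nsGeneratorPairing ν f u
        (BDSV.curl (Torus.fourierTruncate N (u.1 : UnitAddTorus (Fin 3) → EuclideanSpace ℝ (Fin 3))))) μ₀ ∧
      ∫ u : Torus.energySpace (Fin 3), Torus.nsGeneratorPairing ν f u (BDSV.curl (Torus.fourierTruncate N (u.1 : UnitAddTorus (Fin 3) → EuclideanSpace ℝ (Fin 3)))) ∂μ₀ = 0) →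
    (∀ (m : ℕ) (g : Fin m → UnitAddTorus (Fin 3) → EuclideanSpace ℝ (Fin 3))
      (P : MvPolynomial (Fin m) ℝ),
      (∀ i, (Torus.IsSmooth (g i) ∧ Torus.IsDivFree (g i) ∧ Torus.HasZeroMean (g i) ∧
        ∀ k ∉ (Torus.freqBall N).erase (0 : Fin 3 → ℤ),
          UnitAddTorus.mFourierCoeff (EuclideanSpace.complexify ∘ (g i)) k = 0)) → P.IsHomogeneous 2 →
      (∀ u : Torus.energySpace (Fin 3), (∀ k ∉ (Torus.freqBall N).erase (0 : Fin 3 → ℤ),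
          UnitAddTorus.mFourierCoeff (EuclideanSpace.complexify ∘ (u.1 : UnitAddTorus (Fin 3) → EuclideanSpace ℝ (Fin 3))) k = 0) →
        Torus.nsGeneratorPairing (d := Fin 3) 0 0 u
          (fun x => ∑ i, (MvPolynomial.eval (fun j => Torus.pairing u.1 (g j))
            (MvPolynomial.pderiv i P)) • g i x) = 0) →
      ∃ α β : ℝ, ∀ u : Torus.energySpace (Fin 3), (∀ k ∉ (Torus.freqBall N).erase (0 : Fin 3 → ℤ),
          UnitAddTorus.mFourierCoeff (EuclideanSpace.complexify ∘ (u.1 : UnitAddTorus (Fin 3) → EuclideanSpace ℝ (Fin 3))) k = 0) →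
        ∀ x, (∑ i, (MvPolynomial.eval (fun j => Torus.pairing u.1 (g j))
            (MvPolynomial.pderiv i P)) • g i x) =
          (2 * α) • Torus.fourierTruncate N (u.1 : UnitAddTorus (Fin 3) → EuclideanSpace ℝ (Fin 3)) x +
          (2 * β) • BDSV.curl (Torus.fourierTruncate N (u.1 : UnitAddTorus (Fin 3) → EuclideanSpace ℝ (Fin 3))) x) →
    ∃ μ₁ : Measure (Torus.energySpace (Fin 3)), IsProbabilityMeasure μ₁ ∧ (∀ᵐ u ∂μ₁, (∀ k ∉ (Torus.freqBall N).erase (0 : Fin 3 → ℤ),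
          UnitAddTorus.mFourierCoeff (EuclideanSpace.complexify ∘ (u.1 : UnitAddTorus (Fin 3) → EuclideanSpace ℝ (Fin 3))) k = 0)) ∧
      Integrable (fun u : Torus.energySpace (Fin 3) => ‖u‖ ^ 4) μ₁ ∧
      (∀ (m : ℕ) (g : Fin m → UnitAddTorus (Fin 3) → EuclideanSpace ℝ (Fin 3))
      (P : MvPolynomial (Fin m) ℝ),
      (∀ i, (Torus.IsSmooth (g i) ∧ Torus.IsDivFree (g i) ∧ Torus.HasZeroMean (g i) ∧
        ∀ k ∉ (Torus.freqBall N).erase (0 : Fin 3 → ℤ),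
          UnitAddTorus.mFourierCoeff (EuclideanSpace.complexify ∘ (g i)) k = 0)) → P.totalDegree ≤ 4 →
      (∀ u : Torus.energySpace (Fin 3), (∀ k ∉ (Torus.freqBall N).erase (0 : Fin 3 → ℤ),
          UnitAddTorus.mFourierCoeff (EuclideanSpace.complexify ∘ (u.1 : UnitAddTorus (Fin 3) → EuclideanSpace ℝ (Fin 3))) k = 0) →
        0 ≤ MvPolynomial.eval (fun j => Torus.pairing u.1 (g j)) P) →
      (∃ u : Torus.energySpace (Fin 3), (∀ k ∉ (Torus.freqBall N).erase (0 : Fin 3 → ℤ),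
          UnitAddTorus.mFourierCoeff (EuclideanSpace.complexify ∘ (u.1 : UnitAddTorus (Fin 3) → EuclideanSpace ℝ (Fin 3))) k = 0) ∧
        MvPolynomial.eval (fun j => Torus.pairing u.1 (g j)) P ≠ 0) →
      0 < ∫ u, MvPolynomial.eval (fun j => Torus.pairing u.1 (g j)) P ∂μ₁) ∧
      (∀ (m : ℕ) (g : Fin m → UnitAddTorus (Fin 3) → EuclideanSpace ℝ (Fin 3))
      (P : MvPolynomial (Fin m) ℝ),
      (∀ i, (Torus.IsSmooth (g i) ∧ Torus.IsDivFree (g i) ∧ Torus.HasZeroMean (g i) ∧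
        ∀ k ∉ (Torus.freqBall N).erase (0 : Fin 3 → ℤ),
          UnitAddTorus.mFourierCoeff (EuclideanSpace.complexify ∘ (g i)) k = 0)) → P.totalDegree + 1 ≤ 3 →
      Integrable (fun u : Torus.energySpace (Fin 3) => Torus.nsGeneratorPairing ν f u
          (fun x => ∑ i, (MvPolynomial.eval (fun j => Torus.pairing u.1 (g j))
            (MvPolynomial.pderiv i P)) • g i x)) μ₁ ∧
      ∫ u, Torus.nsGeneratorPairing ν f u
          (fun x => ∑ i, (MvPolynomial.eval (fun j => Torus.pairing u.1 (g j))
            (MvPolynomial.pderiv i P)) • g i x) ∂μ₁ = 0) ∧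
      Torus.ensembleEnergy μ₁ = Torus.ensembleEnergy μ₀ ∧
      Torus.ensembleDissipation ν μ₁ = Torus.ensembleDissipation ν μ₀ :=
  order3Surgery

end Summit.AnomalousDissipation.AnomalousDissipation.Theorems.MomentParityQuarticGate
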